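import Mathlib.RingTheory.MvPolynomial.WeightedHomogeneous
import Mathlib.Data.Fin.Tuple.NatAntidiagonal
import Mathlib.Algebra.BigOperators.Fin
import Mathlib.Algebra.BigOperators.Ring.List
import HarnessLib

/-!
# Weighted homogeneous components of products (Strassen's component-wise expansion)

Support module for the `HomRel` family of route `DepthWindow`
(`Theorems/DepthWindowHomRel.lean`, crux item `HomSubReach`).  The algebraic core of
*slope-1 homogenisation of a product gate*: for weights `w : σ → ℕ`,

* `weightedHomogeneousComponent_mul` — the weight-`n` component of `p * q` is
  `∑ (i,j) ∈ antidiagonal n, p_i * q_j`;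
* `weightedHomogeneousComponent_prod_univ` — the weight-`n` component of `∏ i : Fin t, v i`
  is the sum over the weak compositions `f ∈ List.Nat.antidiagonalTuple t n` of
  `∏ i, (v i)_{f i}` (and its `List.prod` form);
* `isWeightedHomogeneous_prod_components` — each such product is weighted homogeneous of
  weight `n`;
* `length_antidiagonalTuple_le` — the number of compositions is `≤ (t + 1) ^ n`.

Consequently a product gate of fan-in `t` inside a block of weighted degree truncation `d` is
replaced, component by component and WITHOUT a new product layer, by `≤ (t + 1) ^ e` product
gates (one per composition) and one sum gate per component `e ≤ d` — the classical
division-free / homogenisation expansion of Strassen, whose cost is polynomial exactly when the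
product fan-in is `2 ^ {O(d)}` (for fan-in-2 formulas this is Raz's observation that
homogenisation preserves product-depth).  This pins the open content of `HomSubReach` to
product gates of fan-in `≥ 2 ^ d`, and is the component algebra the `HomRelStacks` /
`HomRel 1 2` provers need.

[cite: Strassen1973, §3] [cite: Raz2013, §2] [cite: LimayeSrinivasanTavenas2025, Lemma 11, Lemma 19]
-/

set_option linter.dupNamespace false

namespace Summit.ValiantsHypothesis.ValiantsHypothesis.Theorems.DepthWindow

open MvPolynomial Finset
open Finsupp (weight)

variable {σ R : Type*} [CommSemiring R]

/-- **Components of a product, two factors.**  For ℕ-valued weights, the weight-`n`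
component of `p * q` is `∑_{i+j=n} p_i q_j`. [cite: Strassen1973, §3] -/
theorem weightedHomogeneousComponent_mul (w : σ → ℕ) (n : ℕ) (p q : MvPolynomial σ R) :
    weightedHomogeneousComponent w n (p * q) =
      ∑ ij ∈ antidiagonal n,
        weightedHomogeneousComponent w ij.1 p * weightedHomogeneousComponent w ij.2 q := by
  classical
  ext m
  rw [coeff_weightedHomogeneousComponent, coeff_sum]
  simp_rw [coeff_mul, coeff_weightedHomogeneousComponent]
  rw [Finset.sum_comm]
  have key : ∀ x ∈ antidiagonal m,
      (∑ ij ∈ antidiagonal n,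
        (if weight w x.1 = ij.1 then coeff x.1 p else 0) *
          (if weight w x.2 = ij.2 then coeff x.2 q else 0)) =
      if weight w m = n then coeff x.1 p * coeff x.2 q else 0 := by
    intro x hx
    have hwt : weight w x.1 + weight w x.2 = weight w m := by
      rw [← map_add, Finset.mem_antidiagonal.mp hx]
    have step : ∀ ij ∈ antidiagonal n,
        (if weight w x.1 = ij.1 then coeff x.1 p else 0) *
          (if weight w x.2 = ij.2 then coeff x.2 q else 0) =
        if ij = (weight w x.1, weight w x.2) then coeff x.1 p * coeff x.2 q else 0 := by
      intro ij _
      by_cases h1 : weight w x.1 = ij.1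
      · by_cases h2 : weight w x.2 = ij.2
        · have h12 : ij = (weight w x.1, weight w x.2) := Prod.ext h1.symm h2.symm
          rw [if_pos h1, if_pos h2, if_pos h12]
        · have h12 : ij ≠ (weight w x.1, weight w x.2) := fun hh => h2 (by rw [hh])
          rw [if_neg h2, mul_zero, if_neg h12]
      · have h12 : ij ≠ (weight w x.1, weight w x.2) := fun hh => h1 (by rw [hh])
        rw [if_neg h1, zero_mul, if_neg h12]
    rw [Finset.sum_congr rfl step, Finset.sum_ite_eq']
    simp only [Finset.mem_antidiagonal, hwt]
  rw [Finset.sum_congr rfl key]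
  by_cases h : weight w m = n
  · simp [h]
  · simp [h]

/-- Finset sums over `antidiagonal n` as list sums over `List.Nat.antidiagonal n`. -/
theorem sum_antidiagonal_eq_list_sum {β : Type*} [AddCommMonoid β] (n : ℕ) (g : ℕ × ℕ → β) :
    ∑ ij ∈ antidiagonal n, g ij = ((List.Nat.antidiagonal n).map g).sum := by
  rw [Finset.sum_eq_multiset_sum]
  rfl

/-- `List.flatMap` commutes with sums (local helper). -/
theorem sum_flatMap {α β : Type*} [AddMonoid β] (l : List α) (h : α → List β) :
    (l.flatMap h).sum = (l.map fun a => (h a).sum).sum := by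
  induction l with
  | nil => rfl
  | cons a l ih => rw [List.flatMap_cons, List.sum_append, List.map_cons, List.sum_cons, ih]

/-- **Components of a product, `t` factors (Strassen's expansion).**  The weight-`n` component
of `∏ i : Fin t, v i` is the sum, over the weak compositions `f` of `n` into `t` parts, of
`∏ i, (v i)_{f i}`. [cite: Strassen1973, §3] [cite: Raz2013, §2] -/
theorem weightedHomogeneousComponent_prod_univ (w : σ → ℕ) :
    ∀ (t n : ℕ) (v : Fin t → MvPolynomial σ R),
      weightedHomogeneousComponent w n (∏ i, v i) =
        ((List.Nat.antidiagonalTuple t n).map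
          fun f => ∏ i, weightedHomogeneousComponent w (f i) (v i)).sum
  | 0, 0, v => by
      classical
      simp [(isWeightedHomogeneous_one R w).weightedHomogeneousComponent_same]
  | 0, n + 1, v => by
      classical
      simp [(isWeightedHomogeneous_one R w).weightedHomogeneousComponent_ne (n + 1) (by omega)]
  | t + 1, n, v => by
      classical
      rw [Fin.prod_univ_succ, weightedHomogeneousComponent_mul, List.Nat.antidiagonalTuple,
        List.map_flatMap, sum_flatMap, sum_antidiagonal_eq_list_sum]
      congr 1
      refine List.map_congr_left fun ij _ => ?_
      rw [weightedHomogeneousComponent_prod_univ w t ij.2 (fun i => v i.succ),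
        ← List.sum_map_mul_left, List.map_map]
      congr 1
      refine List.map_congr_left fun x _ => ?_
      simp only [Function.comp_apply]
      rw [Fin.prod_univ_succ]
      simp only [Fin.cons_zero, Fin.cons_succ]

/-- List form of `weightedHomogeneousComponent_prod_univ` (a product gate evaluates the
`List.prod` of its operand values). [cite: Strassen1973, §3] -/
theorem weightedHomogeneousComponent_list_prod (w : σ → ℕ) (n : ℕ)
    (l : List (MvPolynomial σ R)) :
    weightedHomogeneousComponent w n l.prod =
      ((List.Nat.antidiagonalTuple l.length n).map
        fun f => ∏ i : Fin l.length, weightedHomogeneousComponent w (f i) (l.get i)).sum := by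
  have h := weightedHomogeneousComponent_prod_univ w l.length n l.get
  rwa [← List.prod_ofFn, List.ofFn_get] at h

/-- Each term of Strassen's expansion is weighted homogeneous of the right weight.
[cite: Strassen1973, §3] -/
theorem isWeightedHomogeneous_prod_components (w : σ → ℕ) {t n : ℕ}
    (v : Fin t → MvPolynomial σ R) {f : Fin t → ℕ} (hf : f ∈ List.Nat.antidiagonalTuple t n) :
    IsWeightedHomogeneous w (∏ i, weightedHomogeneousComponent w (f i) (v i)) n := by
  rw [← List.Nat.mem_antidiagonalTuple.mp hf]
  exact IsWeightedHomogeneous.prod Finset.univ _ _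
    fun i _ => weightedHomogeneousComponent_isWeightedHomogeneous (f i) (v i)

/-- **Counting the compositions**: `|antidiagonalTuple t n| ≤ (t + 1) ^ n` — the size cost of
expanding one product gate of fan-in `t` at weighted degree `n` (exactly
`Nat.choose (n + t - 1) (t - 1)` for `t ≥ 1`). [cite: Raz2013, §2] -/
theorem length_antidiagonalTuple_le :
    ∀ t n : ℕ, (List.Nat.antidiagonalTuple t n).length ≤ (t + 1) ^ n
  | 0, 0 => by simp
  | 0, n + 1 => by simp
  | t + 1, n => by
      rw [List.Nat.antidiagonalTuple, List.length_flatMap]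
      simp only [List.length_map]
      induction n with
      | zero =>
          simp [List.Nat.antidiagonal_zero, List.Nat.antidiagonalTuple_zero_right]
      | succ n ih =>
          rw [List.Nat.antidiagonal_succ, List.map_cons, List.sum_cons, List.map_map]
          have h1 : (List.Nat.antidiagonalTuple t (n + 1)).length ≤ (t + 1) ^ (n + 1) :=
            length_antidiagonalTuple_le t (n + 1)
          have h2 : ((List.Nat.antidiagonal n).map
              ((fun a : ℕ × ℕ => (List.Nat.antidiagonalTuple t a.2).length) ∘
                Prod.map Nat.succ id)).sum ≤ (t + 1 + 1) ^ n := ih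
          have h3 : (t + 1) ^ (n + 1) ≤ (t + 1) * (t + 1 + 1) ^ n := by
            rw [pow_succ']
            exact Nat.mul_le_mul_left _ (Nat.pow_le_pow_left (by omega) n)
          calc (List.Nat.antidiagonalTuple t (n + 1)).length +
                ((List.Nat.antidiagonal n).map
                  ((fun a : ℕ × ℕ => (List.Nat.antidiagonalTuple t a.2).length) ∘
                    Prod.map Nat.succ id)).sum
              ≤ (t + 1) * (t + 1 + 1) ^ n + (t + 1 + 1) ^ n :=
                Nat.add_le_add (h1.trans h3) h2
            _ = (t + 1 + 1) ^ (n + 1) := by ring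

/-- Packaging for the circuit provers: the weight-`e` component of a fan-in-`t` product is a
sum of at most `(t + 1) ^ e` products of components of the factors, each weighted homogeneous of
weight `e` — i.e. ONE extra sum gate and `≤ (t + 1) ^ e` product gates, no extra product LAYER.
[cite: Strassen1973, §3] [cite: Raz2013, §2] [cite: LimayeSrinivasanTavenas2025, Lemma 19] -/
theorem strassen_expansion (w : σ → ℕ) (t e : ℕ) (v : Fin t → MvPolynomial σ R) :
    ∃ L : List (Fin t → ℕ),
      L.length ≤ (t + 1) ^ e ∧
      (∀ f ∈ L, ∑ i, f i = e) ∧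
      (∀ f ∈ L, IsWeightedHomogeneous w (∏ i, weightedHomogeneousComponent w (f i) (v i)) e) ∧
      weightedHomogeneousComponent w e (∏ i, v i) =
        (L.map fun f => ∏ i, weightedHomogeneousComponent w (f i) (v i)).sum :=
  ⟨List.Nat.antidiagonalTuple t e, length_antidiagonalTuple_le t e,
    fun _ hf => List.Nat.mem_antidiagonalTuple.mp hf,
    fun _ hf => isWeightedHomogeneous_prod_components w v hf,
    weightedHomogeneousComponent_prod_univ w t e v⟩

end Summit.ValiantsHypothesis.ValiantsHypothesis.Theorems.DepthWindow
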